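import Summits.QuantumFields.YangMills.Theorems.BalabanUVNodesN08AlphaEq324RowCore

/-!
# Route «BalabanUVNodes», Track-A DAG node N08 = [Balaban1985UV3] Thm 1 p. 257 ∕ Thm 2 p. 272 — THE RANGE-HONEST CORE (α) CLAUSE: the auxiliary
# expansion data carried only on the run's steps `k < K` (`AlphaDataLT`), the core step list keyed on `hk : k + 1 ≤ K` (`StepAlphaEq324CoreLT`), implied by
# the core clause over the lane's `AlphaData`, and the lane's END THEOREMS re-derived — so that the data bundle of the END theorem is INHABITABLE for every
# record (dag-n08-d's located typing looseness 13C ∕ `N08-ALPHA-LOCATED-g6` §2: `AlphaData` is EMPTY for `r₀ = 2`)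

Cell `pub-ymgap`, seat `pub-ymgap-dag-n08-w4` gen 0 (INTENT-5; sequel of `…N08AlphaEq324RowCore` p588551 ✓).  `bears_on: R4∕N08`; filed
`--supports stmt-QuantumFields-20542` (K1⁷).  One `Type`-structure + two `Prop`-structures + one `def` + theorems; sorry-free; standard axioms; the lane's
`Summits/QuantumFields/Balaban3D/Proofs/*` files consumed BY NAME and untouched (this is a Summits∕YangMills-side EDITION, not the custodian's lane edit).

THE LOCATED POINT (dag-n08-d g6, `…N08AlphaFarCurrency` p520790 `isEmpty_alphaData_of_r₀_eq_two`).  The lane's auxiliary bundle `UVStability3DInputs.AlphaData`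
carries the GAP binders G3D-07 «(63) as cited» (`Λc k`) and G3D-08 (`N45 k`) at EVERY `k : ℕ`, also beyond the run; G3D-07's field `far_le` (G3D-06 for the
localized far monomials) has the right side `Cfar·C63·e^{−κ𝓛}·g_k⁷(r(g_k)p(g_k))⁷`, NEGATIVE at steps with `g_k > e` when `r₀ = 2` (`cos 2π·cos 5π = −1`), and
every lattice approximation has such steps beyond `K` (`exists_gk_gt`) — so for a record with `r₀ = 2`, `Cfar·C63 > 0` the bundle is EMPTY and every END theorem
over it is vacuous.  The run READS `Λc k`∕`N45 k` only for `k + 1 ≤ K` (`newborn46_std`, `decomp35_61_pieces`).  This file types the range-honest bundle and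
clause and re-derives the END theorems; the sequel `…Eq324RowRangeZero` INHABITS the bundle at zero data for EVERY record (no `hfar`).
* §1 `AlphaDataLT` (fields `Λc : ∀ k, k + 1 ≤ S.K → LogZLocalizedAsCited …`, `N45 : ∀ k hk, NewbornTerms45AsCited … (Λc k hk) C45`, `cP`, `C₂₃ c₂₃ M₂₃ δ₀`;
  NO `Bv` — idle in the core currency); `AlphaData.restrictLT` (the lane's bundle restricted to the run).
* §2 `StepAlphaEq324CoreLT k hk` (= `StepAlphaEq324Core k` over `AlphaDataLT`, `hPYZ` reading `𝔄.Λc k hk`), `RunAlphaEq324CoreLT`; `coreLT_of_core`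
  (`RunAlphaEq324Core 𝔄 → RunAlphaEq324CoreLT 𝔄.restrictLT`), hence `coreLT_of_runAlpha` from the lane's CURRENT clause.
* §3 reductions: `stepResiduals_of_coreLT_of_thresholds`, `runResiduals_of_alphaEq324CoreLT` (exhibited family), `runResiduals_of_alphaEq324CoreLT_le`
  (≤-family); ★ `uvStability3D_of_inputsEq324CoreLT`, ★ `uvStability3D_of_inputsEq324CoreLT_le` — the lane's END theorems from the range-honest core clause.
HONEST SCOPE ∕ A6.  Hypothesis-shape bookkeeping: the range-honest clause is IMPLIED by the lane's (§2), so it inherits every inhabitant; conversely its data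
bundle is inhabitable for every record (sequel), which the lane's is not.  Nothing of [B10] decided (object gap unchanged); not a defect of any landed module.
Count-neutral; N08 NOT discharged; one finite 𝕋⁴ programme at fixed ε, d = 3 tori of [B10] inside the record, Bałaban AS PRINTED; nothing about d = 4, the
continuum, OS axioms, a mass gap or Clay — R4 closes the conditional finite-𝕋⁴ rung `BalabanLadder.UV` only.
-/

noncomputable section

namespace Summit.QuantumFields.YangMills.Theorems.BalabanUVNodesN08AlphaEq324RowRange

open MeasureTheory Metric
open scoped BigOperators Nat Matrix.Norms.L2Operator
open Literature.MathematicalPhysics.QuantumFieldTheory.Balaban1983to89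
open Literature.MathematicalPhysics.QuantumFieldTheory.Balaban1983to89.B10
open Literature.MathematicalPhysics.QuantumFieldTheory.Balaban1983to89.B10SectAGathering
open Literature.MathematicalPhysics.QuantumFieldTheory.Balaban1983to89.B10SectCExpansion (Bound44)
open Literature.MathematicalPhysics.QuantumFieldTheory.Balaban1983to89.TreeLengthTorus (tsys tcubeSys)
open Literature.MathematicalPhysics.QuantumFieldTheory.Balaban1983to89.B1Sect3Statements (Eq324)
open Literature.MathematicalPhysics.QuantumFieldTheory.Balaban1985CMP102
open Literature.MathematicalPhysics.QuantumFieldTheory.Balaban1985CMP102.Setting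
open Literature.MathematicalPhysics.QuantumFieldTheory.Balaban1985CMP102.Theorems
open Literature.MathematicalPhysics.QuantumFieldTheory.Balaban1985CMP102.Binders
  (ChartAnalyticityAsCited FarTermsDecayAsCited Norm35StepAsCited LogZTExtensiveAsCited LogZLocalizedAsCited GraphTerms GraphRep23AsCited)
open Literature.MathematicalPhysics.QuantumFieldTheory.Balaban1985CMP102.BindersNewborn (NewbornTerms45AsCited)
open Summit.QuantumFields.Balaban3D.Carriers
open Summit.QuantumFields.Balaban3D.Proofs
open Summit.QuantumFields.Balaban3D.Proofs.ScalesArithmetic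
open Summit.QuantumFields.Balaban3D.Proofs.Constants
open Summit.QuantumFields.Balaban3D.Proofs.UVStability3D
open Summit.QuantumFields.Balaban3D.Proofs.EndTheorem
open Summit.QuantumFields.Balaban3D.Proofs.Inputs
open Summit.QuantumFields.Balaban3D.Proofs.Residuals
open Summit.QuantumFields.Balaban3D.Proofs.Primitives
open Summit.QuantumFields.Balaban3D.Proofs.Family (small28 gk_le_gamma46 gk_le_gammaOO gk_le_gamma71 prov_hb₁ prov_hb₂)
open Summit.QuantumFields.Balaban3D.Proofs.FamilyLE (ScalesLE runsLE thresholds_of_le)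
open Summit.QuantumFields.Balaban3D.Proofs.Representation33 (jet26)
open Summit.QuantumFields.Balaban3D.Proofs.Newborn46 (newborn46_std)
open Summit.QuantumFields.Balaban3D.Proofs.Bound55Std (Fibre49 Fibre57Low hint_std hint47_std)
open Summit.QuantumFields.Balaban3D.Proofs.LiftBridge (liftCfg)
open Summit.QuantumFields.Balaban3D.Proofs.Run3SmallFactors (codeZ)
open Summit.QuantumFields.Balaban3D.Proofs.GroupModelLieC (lieC)
open Summit.QuantumFields.Balaban3D.Proofs.UVStability3DInputs
open Summit.QuantumFields.YangMills.Theorems.BalabanUVNodesN08AlphaEq324RowSuppliers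
open Summit.QuantumFields.YangMills.Theorems.BalabanUVNodesN08AlphaEq324RowCore
open B7Prop1Explicit (hol plaqWord)
open B7Prop1Local (pdevOn loK plaqHiK)
open B7Prop2Explicit (avgIter)

variable {L : ℕ}

/-! ## §1 The auxiliary expansion data ON THE RUN'S STEPS ONLY -/

section Data

variable {S : Scales L} {G : Type} [GaugeGroup G] [MeasurableSpace G] [HaarData G] (𝔊 : GroupModel G) (𝔠 : AlphaConsts L 𝔊.N)
  (X : ExternalInputs S G) (𝔖 : ∀ k, StepSeries S G ↥(lieC 𝔊) (nblkOf S 𝔠.lane.carrier k) k)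

/-- **RANGE-HONEST AUXILIARY EXPANSION DATA** — `UVStability3DInputs.AlphaData` with the GAP binders G3D-07 «(63) as cited» and G3D-08 carried ONLY at the
run's steps `k + 1 ≤ K` (the only ones the run reads), the interaction bound `cP` and the G3D-02 constants as there, and NO box bound `Bv` (idle in the
source-faithful core currency).  DATA; nothing asserted. [cite: Balaban1985UV3, (23) p.262 + (45) p.267 + (63) p.272] -/
structure AlphaDataLT where
  /-- G3D-07 «(63) as cited» at step `k < K` -/
  Λc : ∀ k, k + 1 ≤ S.K → LogZLocalizedAsCited (towerOf 𝔠.lane X 𝔖) k (𝔖 k).E (adjAct 𝔊 (P := S.P) k) 𝔠.ρ 𝔠.r₀ 𝔠.Cfar 𝔠.C63 𝔠.κ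
    (pieces 𝔠.lane X 𝔖 k).logZU (pieces 𝔠.lane X 𝔖 k).logZ1 (𝔖 k).Bcfg
    (fun h => Finset.univ.filter fun Y : (tsys 3 (nblkOf S 𝔠.lane.carrier k)).Dom =>
      Y.1 ⊆ ΩblkOf 𝔠.lane.carrier.M₁ (rcolOf S 𝔠.lane.carrier) (nblkOf S 𝔠.lane.carrier k) h)
  /-- G3D-08 «(45) as cited» for the (61)-born pieces of `Λc k hk`, at step `k < K` -/
  N45 : ∀ k (hk : k + 1 ≤ S.K), NewbornTerms45AsCited (towerOf 𝔠.lane X 𝔖) k (𝔖 k).E (adjAct 𝔊 (P := S.P) k) 𝔠.ρ 𝔠.r₀ 𝔠.Cfar 𝔠.C63 𝔠.κ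
    (pieces 𝔠.lane X 𝔖 k).logZU (pieces 𝔠.lane X 𝔖 k).logZ1 (𝔖 k).Bcfg
    (fun h => Finset.univ.filter fun Y : (tsys 3 (nblkOf S 𝔠.lane.carrier k)).Dom =>
      Y.1 ⊆ ΩblkOf 𝔠.lane.carrier.M₁ (rcolOf S 𝔠.lane.carrier) (nblkOf S 𝔠.lane.carrier k) h) (Λc k hk) 𝔠.C45
  /-- upper bound of the interaction sum `Pint k` of (43), per step -/
  cP : ℕ → ℝ
  /-- G3D-02 constants of (23), per step -/
  C₂₃ : ℕ → ℝ
  /-- G3D-02 constants of (23), per step -/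
  c₂₃ : ℕ → ℝ
  /-- G3D-02 constants of (23), per step -/
  M₂₃ : ℕ → ℝ
  /-- G3D-02 constants of (23), per step -/
  δ₀ : ℕ → ℝ

variable {𝔊 𝔠 X 𝔖}

/-- **The lane's bundle restricted to the run** (forget `Bv` and the binders beyond `K`). [cite: Balaban1985UV3, (63) p.272 (bookkeeping)] -/
def restrictLT (𝔄 : AlphaData 𝔊 𝔠 X 𝔖) : AlphaDataLT 𝔊 𝔠 X 𝔖 where
  Λc k _ := 𝔄.Λc k
  N45 k _ := 𝔄.N45 k
  cP := 𝔄.cP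
  C₂₃ := 𝔄.C₂₃
  c₂₃ := 𝔄.c₂₃
  M₂₃ := 𝔄.M₂₃
  δ₀ := 𝔄.δ₀

end Data

/-! ## §2 The range-honest core step list and run clause -/

section Alpha

variable {S : Scales L} {G : Type} [GaugeGroup G] [MeasurableSpace G] [HaarData G] (𝔊 : GroupModel G) (𝔠 : AlphaConsts L 𝔊.N)
  (X : ExternalInputs S G) (𝔖 : ∀ k, StepSeries S G ↥(lieC 𝔊) (nblkOf S 𝔠.lane.carrier k) k) (𝔄 : AlphaDataLT 𝔊 𝔠 X 𝔖)

open Classical in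
/-- **THE CORE (α) INPUTS OF STEP `k → k+1`, `k < K`, OVER THE RANGE-HONEST BUNDLE** — `…RowCore.StepAlphaEq324Core k` row for row, the identification `hPYZ`
reading the bundle's `Λc k hk`.  HYPOTHESES. [cite: Balaban1985UV3, (23)–(33) pp.262–264 + (44) p.267 + (55)–(63) pp.269–272; Balaban1982Higgs1, (3.24) p.616] -/
structure StepAlphaEq324CoreLT (k : ℕ) (hk : k + 1 ≤ S.K) : Prop where
  /-- G3D-01 at the (25)-rate (R-ACT) -/
  chart : ∀ Y, ChartAnalyticityAsCited ((𝔖 k).Ψ Y) 𝔠.ρ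
    (𝔠.C25 * S.gk k * Real.exp (-(𝔠.κ * (tsys 3 (nblkOf S 𝔠.lane.carrier k)).dj Y)))
  /-- (28) p. 263 -/
  bound28 : ∀ Y h U, ‖(𝔖 k).Bcfg Y h U‖ ≤ 𝔠.cB * (rFun 𝔠.r₀ (S.gk k) * S.gk k * pFun 𝔠.b₀ 𝔠.p₀ (S.gk k))
  /-- (26) in the chart space, for the adjoint action -/
  inv26 : ∀ Y (U : G), ∀ b ∈ ball (0 : (𝔖 k).E) 𝔠.ρ, adjAct 𝔊 (P := S.P) k U b ∈ ball (0 : (𝔖 k).E) 𝔠.ρ →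
    (𝔖 k).Ψ Y (adjAct 𝔊 (P := S.P) k U b) = (𝔖 k).Ψ Y b
  /-- G3D-06 -/
  far_le : FarTermsDecayAsCited (𝔖 k).far
    (fun Y => 𝔠.C25 * S.gk k * Real.exp (-(𝔠.κ * (tsys 3 (nblkOf S 𝔠.lane.carrier k)).dj Y)))
    𝔠.Cfar (S.gk k ^ 7 * (rFun 𝔠.r₀ (S.gk k) * pFun 𝔠.b₀ 𝔠.p₀ (S.gk k)) ^ 7)
  /-- identification of `PY` with the retained jet -/
  hPY : ∀ h U, (𝔖 k).PY h U
    = ∑ Y ∈ (𝔖 k).loc (ΩblkOf 𝔠.lane.carrier.M₁ (rcolOf S 𝔠.lane.carrier) (nblkOf S 𝔠.lane.carrier k)) (rretOf S 𝔠.lane.carrier k) h,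
        ((jet26 ((𝔖 k).Ψ Y) ((𝔖 k).Bcfg Y h U)).re - (𝔖 k).far Y h U)
  /-- identification of `PYZ` with the retained jet of the G3D-07 pieces AT THIS RUN STEP -/
  hPYZ : ∀ h U, (𝔖 k).PYZ h U
    = ∑ Y ∈ (𝔖 k).loc (ΩblkOf 𝔠.lane.carrier.M₁ (rcolOf S 𝔠.lane.carrier) (nblkOf S 𝔠.lane.carrier k)) (rretOf S 𝔠.lane.carrier k) h,
        ((jet26 ((𝔄.Λc k hk).Ψ Y) ((𝔖 k).Bcfg Y h U)).re - (𝔄.Λc k hk).far Y h U)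
  /-- G3D-04 -/
  norm35 : Norm35StepAsCited (pieces 𝔠.lane X 𝔖 k) 𝔠.c35 𝔠.a35 𝔠.cv 𝔠.cJ35
  /-- G3D-05 -/
  logZT : LogZTExtensiveAsCited (pieces 𝔠.lane X 𝔖 k) 𝔠.cT 𝔠.aT 𝔠.cn 𝔠.cJT
  /-- R-ACT -/
  hact : ∀ h Y U, ((𝔖 k).Gt h).activities.act Y U = (𝔖 k).act h Y U
  /-- G3D-02 -/
  hG : ∀ h, GraphRep23AsCited ((𝔖 k).Gt h) (fun U => ∑ n ∈ Finset.Icc 1 𝔠.nbar, (𝔖 k).cum h U n / (n.factorial : ℝ))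
    (𝔄.C₂₃ k) (𝔄.c₂₃ k) (𝔄.M₂₃ k) (𝔄.δ₀ k)
  /-- [B1] (3.24) AS PRINTED for the step's fluctuation integral over the small-field box -/
  h324 : ∀ h (U : GaugeField S.P (k + 1) G),
    Eq324 (∫ ω in (𝔖 k).box h, Real.exp ((𝔖 k).𝒱 h U ω) ∂(𝔖 k).μ) ((𝔖 k).cum h U) 𝔠.nbar (𝔠.Ca + 𝔠.Cc)
      ((L : ℝ) ^ k * S.g0sq) (3 + 𝔠.κ₀) (S.sites k)
  /-- (44) p. 267 on the previous-scale terms of the data -/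
  h44 : ∀ (h : Hist S.P (k + 1)) (U : GaugeField S.P (k + 1) G), ∀ j ∈ Finset.Icc 1 k,
    Bound44 (oldGeom S.P k j) (fun y n c => (𝔖 k).oldVal h U j y n c) 𝔠.κ₁ (𝔠.M₁ : ℝ) (ell S.P k j) (L : ℝ) 𝔠.B₃
      (S.gk k) (pFun 𝔠.b₀ 𝔠.p₀ (S.gk k)) 𝔠.C44
  /-- the degree floor «n ≥ 2» of (43) -/
  hfloor : ∀ (h : Hist S.P (k + 1)) (U : GaugeField S.P (k + 1) G), ∀ j ∈ Finset.Icc 1 k,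
    ∀ (y : Site S.P j) (n : ℕ) (c : Fin n → PBond S.P j), (𝔖 k).oldVal h U j y n c ≠ 0 → 2 ≤ n
  /-- EXTERNAL-input property ([7] Thm 1): `U_k(·, h)` measurable -/
  hU : ∀ h : Hist S.P k, Measurable (X.UkH k h)
  /-- `Pint k h` measurable … -/
  hPm : ∀ h : Hist S.P k, Measurable ((inputOf 𝔠.lane X 𝔖).Pint k h)
  /-- … and bounded above -/
  hPb : ∀ (h : Hist S.P k) (U : GaugeField S.P k G), (inputOf 𝔠.lane X 𝔖).Pint k h U ≤ 𝔄.cP k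
  /-- RESIDUAL R3D-01 (p4) -/
  fibre49 : ∀ h' : Hist S.P (k + 1), Fibre49 X 𝔠.lane.carrier 𝔖 (fun _ => True) k (piecesW 𝔠.lane X 𝔖 k) h'
  /-- RESIDUAL R3D-02 (p4) -/
  fibre57Low : Fibre57Low X 𝔠.lane.carrier 𝔖 (fun _ => True) k (piecesW 𝔠.lane X 𝔖 k)

/-- **THE RANGE-HONEST CORE (α) CLAUSE OF ONE LATTICE APPROXIMATION**: the core step inputs at every run step `k < K` + the two B25 displays (67)∘LF, (68).
HYPOTHESES. [cite: Balaban1985UV3, (67)–(68) p.273 + pp.273–274] -/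
structure RunAlphaEq324CoreLT : Prop where
  /-- the core step inputs, keyed on the run step -/
  steps : ∀ k (hk : k + 1 ≤ S.K), StepAlphaEq324CoreLT 𝔊 𝔠 X 𝔖 𝔄 k hk
  /-- (67) ∘ the large-field characteristic function of the history, on the averaged lifted minimizers -/
  hLF67 : ∀ k, k ≤ S.K → ∀ (h : Hist S.P k), Hist.Admissible 𝔠.lane.carrier.M₁ (rcolOf S 𝔠.lane.carrier) k h →
    ∀ (U : GaugeField S.P k G), ∀ e ∈ Hist.disc h, S.gk e.1 * pFun 𝔠.lane.carrier.b₀ 𝔠.lane.carrier.p₀ (S.gk e.1) ≤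
      ‖((hol (avgIter L (liftCfg 𝔊 (X.UkH k h U)) e.1) (codeZ e) (plaqWord e.2.2.1 e.2.2.2) :
          (Matrix (Fin 𝔊.N) (Fin 𝔊.N) ℂ)ˣ) : Matrix (Fin 𝔊.N) (Fin 𝔊.N) ℂ) - 1‖
  /-- (68) on the lifted minimizers -/
  h68 : ∀ k, k ≤ S.K → ∀ (h : Hist S.P k), Hist.Admissible 𝔠.lane.carrier.M₁ (rcolOf S 𝔠.lane.carrier) k h →
    ∀ (U : GaugeField S.P k G), ∀ e ∈ Hist.disc h,
      pdevOn (loK L e.1 (codeZ e)) (plaqHiK L e.1 (codeZ e) e.2.2.1 e.2.2.2) (liftCfg 𝔊 (X.UkH k h U)) <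
        𝔠.C68 * (S.gk e.1 * pFun 𝔠.lane.carrier.b₀ 𝔠.lane.carrier.p₀ (S.gk e.1)) * (((L : ℝ) ^ e.1)⁻¹) ^ 2

end Alpha

section FromCore

variable {S : Scales L} {G : Type} [GaugeGroup G] [MeasurableSpace G] [HaarData G] {𝔊 : GroupModel G} {𝔠 : AlphaConsts L 𝔊.N}
  {X : ExternalInputs S G} {𝔖 : ∀ k, StepSeries S G ↥(lieC 𝔊) (nblkOf S 𝔠.lane.carrier k) k}

/-- **THE CORE CLAUSE OVER THE LANE'S BUNDLE GIVES THE RANGE-HONEST CLAUSE OVER ITS RESTRICTION**, step by step (every row verbatim).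
[cite: Balaban1985UV3, (63) p.272 (bookkeeping)] -/
theorem stepCoreLT_of_core {𝔄 : AlphaData 𝔊 𝔠 X 𝔖} {k : ℕ} (hk : k + 1 ≤ S.K) (A : StepAlphaEq324Core 𝔊 𝔠 X 𝔖 𝔄 k) :
    StepAlphaEq324CoreLT 𝔊 𝔠 X 𝔖 (restrictLT 𝔄) k hk where
  chart := A.chart
  bound28 := A.bound28
  inv26 := A.inv26
  far_le := A.far_le
  hPY := A.hPY
  hPYZ := A.hPYZ
  norm35 := A.norm35
  logZT := A.logZT
  hact := A.hact
  hG := A.hG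
  h324 := A.h324
  h44 := A.h44
  hfloor := A.hfloor
  hU := A.hU
  hPm := A.hPm
  hPb := A.hPb
  fibre49 := A.fibre49
  fibre57Low := A.fibre57Low

/-- … and run by run. [cite: Balaban1985UV3, (67)–(68) p.273 (bookkeeping)] -/
theorem coreLT_of_core {𝔄 : AlphaData 𝔊 𝔠 X 𝔖} (R : RunAlphaEq324Core 𝔊 𝔠 X 𝔖 𝔄) : RunAlphaEq324CoreLT 𝔊 𝔠 X 𝔖 (restrictLT 𝔄) where
  steps k hk := stepCoreLT_of_core hk (R.steps k hk)
  hLF67 := R.hLF67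
  h68 := R.h68

/-- **THE LANE'S CURRENT (α) CLAUSE IMPLIES THE RANGE-HONEST CORE CLAUSE** over the restricted bundle. [cite: Balaban1985UV3, (63) p.272 (bookkeeping)] -/
theorem coreLT_of_runAlpha {𝔄 : AlphaData 𝔊 𝔠 X 𝔖} (R : RunAlpha 𝔊 𝔠 X 𝔖 𝔄) : RunAlphaEq324CoreLT 𝔊 𝔠 X 𝔖 (restrictLT 𝔄) :=
  coreLT_of_core (core_of_runAlpha R)

end FromCore

/-! ## §3 The residual leaves and the END THEOREMS from the range-honest core clause -/

section Reduce

variable {S : Scales L} {G : Type} [GaugeGroup G] [MeasurableSpace G] [HaarData G] {𝔊 : GroupModel G} {𝔠 : AlphaConsts L 𝔊.N}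
  {X : ExternalInputs S G} {𝔖 : ∀ k, StepSeries S G ↥(lieC 𝔊) (nblkOf S 𝔠.lane.carrier k) k} {𝔄 : AlphaDataLT 𝔊 𝔠 X 𝔖}

/-- (25) at the chart centre over the range-honest list. [cite: Balaban1985UV3, (25) p.262] -/
theorem bound25_vac_coreLT {k : ℕ} {hk : k + 1 ≤ S.K} (A : StepAlphaEq324CoreLT 𝔊 𝔠 X 𝔖 𝔄 k hk) :
    Bound25Printed ⟨(tsys 3 (nblkOf S 𝔠.lane.carrier k)).Dom, GaugeField S.P (k + 1) G, (tsys 3 (nblkOf S 𝔠.lane.carrier k)).dj,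
      fun Y _ => ((𝔖 k).Ψ Y 0).re⟩ (S.gk k) 𝔠.κ 𝔠.C25 := by
  intro Y _
  have hρ : 0 < 𝔠.ρ := (A.chart Y).1
  exact (Complex.abs_re_le_norm _).trans ((A.chart Y).2.2 0 (mem_closedBall_self (by positivity)))

/-- **THE RESIDUAL STEP LEAVES FROM THE RANGE-HONEST CORE STEP INPUTS, GIVEN THE (28)-SMALLNESS AND THE `γ_OO` THRESHOLD** (the body of
`…RowCore.stepResiduals_of_core_of_thresholds` with `𝔄.Λc k ↦ 𝔄.Λc k hk`). [cite: Balaban1985UV3, (55)–(61) pp.269–271 + p.272] -/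
theorem stepResiduals_of_coreLT_of_thresholds {k : ℕ} (hk : k + 1 ≤ S.K) (A : StepAlphaEq324CoreLT 𝔊 𝔠 X 𝔖 𝔄 k hk)
    (hsmall : 𝔠.cB * (rFun 𝔠.r₀ (S.gk k) * S.gk k * pFun 𝔠.b₀ 𝔠.p₀ (S.gk k)) ≤ 𝔠.ρ / 4) (hOO : S.gk k ≤ 𝔠.gammaOO) :
    StepResiduals 𝔠.lane X 𝔖 k := by
  haveI : RegularGaugeGroup G := groupModel_regularGaugeGroup 𝔊
  have hC₂ : 0 ≤ 𝔠.Ca + 0 + 𝔠.Cc := by simpa only [add_zero] using 𝔠.Cac_nonneg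
  have h324' : ∀ h (U : GaugeField S.P (k + 1) G),
      Eq324 (∫ ω in (𝔖 k).box h, Real.exp ((𝔖 k).𝒱 h U ω) ∂(𝔖 k).μ) ((𝔖 k).cum h U) 𝔠.nbar (𝔠.Ca + 0 + 𝔠.Cc)
        ((L : ℝ) ^ k * S.g0sq) (3 + 𝔠.κ₀) (S.sites k) := fun h U => by
    simpa only [add_zero] using A.h324 h U
  have h25 : ∀ h : Hist S.P (k + 1), Bound25Printed ⟨(tsys 3 (nblkOf S 𝔠.lane.carrier k)).Dom, GaugeField S.P (k + 1) G,
      (tsys 3 (nblkOf S 𝔠.lane.carrier k)).dj, (𝔖 k).act h⟩ (S.gk k) 𝔠.κ 𝔠.C25 := fun h =>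
    ChartFromBound25.bound25_real_of_chart (T := towerOf 𝔠.lane X 𝔖) (k := k) (𝔖 k).Ψ A.chart (𝔖 k).Bcfg A.bound28 hsmall h
  exact
  { bound55 := AlphaBound55.bound55_pieces 𝔠.lane X 𝔖 k hk
      (hint_std X 𝔠.lane.carrier 𝔖 (fun _ => True) k A.hU A.hPm (𝔄.cP k) A.hPb) A.fibre49
    bound55Lower := AlphaBound55.bound55Lower_pieces 𝔠.lane X 𝔖 k
      (hint47_std X 𝔠.lane.carrier 𝔖 (fun _ => True) k (A.hU _) (A.hPm _) (𝔄.cP k) (A.hPb _)) A.fibre57Low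
    cumulant58 := cumulant58_pieces_of_eq324_core 𝔠.lane X 𝔖 k hk 𝔠.kappa_ge 𝔠.C25_nonneg 𝔠.one_le_r₀ 𝔠.R₁_ge hC₂ rfl rfl
      A.hact h324' A.hG h25
    cumulantLower := cumulantLower_pieces_of_eq324_core 𝔠.lane X 𝔖 k hk 𝔠.kappa_ge 𝔠.C25_nonneg 𝔠.one_le_r₀ 𝔠.R₁_ge hC₂ rfl
      A.hact h324' A.hG h25
    repr33_60 := AlphaRepr.repr33_60_pieces 𝔠.lane X 𝔖 k hk 𝔠.chart (by linarith [𝔠.kappa_ge]) 𝔠.C25_nonneg 𝔠.C25_le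
      𝔠.κ₀_lt_half rfl A.chart A.bound28 hsmall (adjAct 𝔊 (P := S.P) k) A.inv26
      (hdet_adjAct 𝔊 k) A.far_le A.hPY
    vacuumWhole := AlphaRepr.vacuumWhole_pieces 𝔠.lane X 𝔖 k hk 𝔠.kappa_ge 𝔠.C25_nonneg 𝔠.one_le_r₀ 𝔠.R₁_ge rfl rfl A.chart
    decomp35_61 := AlphaRepr.decomp35_61_pieces 𝔠.lane X 𝔖 k hk 𝔠.chart rfl 𝔠.kappa_ge 𝔠.C63_nonneg 𝔠.C63_le 𝔠.one_le_r₀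
      𝔠.κ₀_lt_half 𝔠.R₁_ge rfl A.bound28 hsmall (adjAct 𝔊 (P := S.P) k) (hdet_adjAct 𝔊 k)
      (𝔄.Λc k hk) A.hPYZ
    norm35 := AlphaRepr.norm35_pieces 𝔠.lane X 𝔖 k 𝔠.c35_pos rfl A.norm35
    oldOutside := AlphaCumulant.oldOutside_pieces 𝔠.lane X 𝔖 k hk 𝔠.C44_nonneg 𝔠.B₃_pos.le 𝔠.κ₁_pos rfl A.h44 A.hfloor hOO }

/-- **THE RESIDUAL LEAVES OF THE RUN FROM THE RANGE-HONEST CORE CLAUSE** on the exhibited family `S.ε₀ = ε₀(S.g)`.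
[cite: Balaban1985UV3, (46) p.267 + (65) p.273 + pp.273–274] -/
theorem runResiduals_of_alphaEq324CoreLT (hS : S.ε₀ = eps0Of 𝔠.gamma0 S.g) (R : RunAlphaEq324CoreLT 𝔊 𝔠 X 𝔖 𝔄) :
    RunResiduals 𝔠.lane X 𝔖 where
  steps k hk := stepResiduals_of_coreLT_of_thresholds hk (R.steps k hk) (small28 hS k (by omega)) (gk_le_gammaOO hS k (by omega))
  bound46 := AlphaLargeField.bound46_tower 𝔠.lane X 𝔖 𝔠.C44_nonneg 𝔠.Cnew_nonneg 𝔠.B₃_pos.le 𝔠.κ₁_pos rfl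
    (fun k hk => (R.steps k hk).h44) (fun k hk => (R.steps k hk).hfloor) (fun k hk => gk_le_gamma46 hS k (by omega))
    (fun k hk => newborn46_std X 𝔠.lane.carrier 𝔖 k (by omega) (by rw [P_m, P_K]; omega) 𝔠.chart (by linarith [𝔠.kappa_ge])
      𝔠.C25_nonneg 𝔠.C63_nonneg 𝔠.b₀_pos.le 𝔠.p₀_pos (lt_of_lt_of_le one_pos 𝔠.one_le_r₀) (R.steps k hk).chart
      (R.steps k hk).bound28 (small28 hS k (by omega)) (R.steps k hk).far_le (R.steps k hk).hPY (𝔄.Λc k hk) (𝔄.N45 k hk)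
      (R.steps k hk).hPYZ)
  logZT_le k hk := AlphaRepr.logZT_le_pieces 𝔠.lane X 𝔖 k 𝔠.cT_pos rfl (R.steps k hk).logZT
  PprT_le k hk := AlphaCumulant.pprT_le_pieces 𝔠.lane X 𝔖 k hk (by linarith [𝔠.kappa_ge]) 𝔠.C25_nonneg rfl
    (bound25_vac_coreLT (R.steps k hk))
  lf := AlphaLargeField.lf_tower 𝔠.lane X 𝔖 𝔊 𝔠.R₁_nonneg (le_trans zero_le_one 𝔠.one_le_r₀)
    (add_nonneg 𝔠.Cz_nonneg 𝔠.Cv_nonneg) 𝔠.C₅_nonneg 𝔠.C₆_nonneg 𝔠.C68_pos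
    (fun j hj => gk_le_gamma71 hS j hj.le) R.hLF67 R.h68 𝔠.prov_r₀p₀ (prov_hb₁ 𝔠 𝔊.N_pos) (prov_hb₂ 𝔠 𝔊.N_pos)

/-- **… and on the `≤`-family `S.g²·S.ε₀ ≤ (min γ₀ 1)²`** (lane `FamilyLE`). [cite: Balaban1985UV3, (46) p.267 + (65) p.273 + pp.273–274] -/
theorem runResiduals_of_alphaEq324CoreLT_le (hle : S.g ^ 2 * S.ε₀ ≤ (min 𝔠.gamma0 1) ^ 2) (R : RunAlphaEq324CoreLT 𝔊 𝔠 X 𝔖 𝔄) :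
    RunResiduals 𝔠.lane X 𝔖 where
  steps k hk := stepResiduals_of_coreLT_of_thresholds hk (R.steps k hk) (thresholds_of_le hle k (by omega)).2.2.2.2
    (thresholds_of_le hle k (by omega)).2.2.1
  bound46 := AlphaLargeField.bound46_tower 𝔠.lane X 𝔖 𝔠.C44_nonneg 𝔠.Cnew_nonneg 𝔠.B₃_pos.le 𝔠.κ₁_pos rfl
    (fun k hk => (R.steps k hk).h44) (fun k hk => (R.steps k hk).hfloor) (fun k hk => (thresholds_of_le hle k (by omega)).2.1)
    (fun k hk => newborn46_std X 𝔠.lane.carrier 𝔖 k (by omega) (by rw [P_m, P_K]; omega) 𝔠.chart (by linarith [𝔠.kappa_ge])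
      𝔠.C25_nonneg 𝔠.C63_nonneg 𝔠.b₀_pos.le 𝔠.p₀_pos (lt_of_lt_of_le one_pos 𝔠.one_le_r₀) (R.steps k hk).chart
      (R.steps k hk).bound28 (thresholds_of_le hle k (by omega)).2.2.2.2 (R.steps k hk).far_le (R.steps k hk).hPY (𝔄.Λc k hk) (𝔄.N45 k hk)
      (R.steps k hk).hPYZ)
  logZT_le k hk := AlphaRepr.logZT_le_pieces 𝔠.lane X 𝔖 k 𝔠.cT_pos rfl (R.steps k hk).logZT
  PprT_le k hk := AlphaCumulant.pprT_le_pieces 𝔠.lane X 𝔖 k hk (by linarith [𝔠.kappa_ge]) 𝔠.C25_nonneg rfl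
    (bound25_vac_coreLT (R.steps k hk))
  lf := AlphaLargeField.lf_tower 𝔠.lane X 𝔖 𝔊 𝔠.R₁_nonneg (le_trans zero_le_one 𝔠.one_le_r₀)
    (add_nonneg 𝔠.Cz_nonneg 𝔠.Cv_nonneg) 𝔠.C₅_nonneg 𝔠.C₆_nonneg 𝔠.C68_pos
    (fun j hj => (thresholds_of_le hle j hj.le).2.2.2.1) R.hLF67 R.h68 𝔠.prov_r₀p₀ (prov_hb₁ 𝔠 𝔊.N_pos) (prov_hb₂ 𝔠 𝔊.N_pos)

end Reduce

section End

/-- ★ **BAŁABAN CMP 102 THEOREM 1 (compact reading) ∧ THEOREM 2 FROM THE RANGE-HONEST CORE (α) CLAUSE** — the lane's `uvStability3D_of_inputs` with the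
auxiliary bundle `AlphaData ↦ AlphaDataLT` (binders on the run's steps only; inhabitable for every record) and `RunAlpha ↦ RunAlphaEq324CoreLT`.
[cite: Balaban1985UV3, Thm 1 p.257 + Thm 2 p.272 + p.256 L15–18] -/
theorem uvStability3D_of_inputsEq324CoreLT
    (𝔠 : ∀ (G : Type) [GaugeGroup G] [MeasurableSpace G] [HaarData G] (𝔊 : GroupModel G), AlphaConsts L 𝔊.N)
    (X : ∀ (G : Type) [GaugeGroup G] [MeasurableSpace G] [HaarData G], GroupModel G → ∀ S : Scales L, ExternalInputs S G)
    (𝔖 : ∀ (G : Type) [GaugeGroup G] [MeasurableSpace G] [HaarData G] (𝔊 : GroupModel G) (S : Scales L) (k : ℕ),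
      StepSeries S G ↥(lieC 𝔊) (nblkOf S (𝔠 G 𝔊).lane.carrier k) k)
    (𝔄 : ∀ (G : Type) [GaugeGroup G] [MeasurableSpace G] [HaarData G] (𝔊 : GroupModel G) (S : Scales L),
      AlphaDataLT 𝔊 (𝔠 G 𝔊) (X G 𝔊 S) (𝔖 G 𝔊 S))
    (hα : ∀ (G : Type) [GaugeGroup G] [MeasurableSpace G] [HaarData G] (𝔊 : GroupModel G) (S : Scales L),
      S.ε₀ = eps0Of (𝔠 G 𝔊).gamma0 S.g → RunAlphaEq324CoreLT 𝔊 (𝔠 G 𝔊) (X G 𝔊 S) (𝔖 G 𝔊 S) (𝔄 G 𝔊 S)) :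
    Thm1AsPrintedCompact (laneT 𝔠 X 𝔖).toConstruction ∧ Thm2AsPrintedC (laneT 𝔠 X 𝔖).toConstruction :=
  uvStability3D_of_residuals (fun G _ _ _ 𝔊 => (𝔠 G 𝔊).lane) (fun G _ _ _ 𝔊 => (𝔠 G 𝔊).gamma0)
    (fun G _ _ _ 𝔊 => (𝔠 G 𝔊).gamma0_pos) (fun _ _ _ _ 𝔊 => lieChart 𝔊) X 𝔖
    (fun G _ _ _ 𝔊 S hS => runResiduals_of_alphaEq324CoreLT hS (hα G 𝔊 S hS))

/-- ★ **… AND ON THE `≤`-FAMILY** (`FamilyLE.uvStability3D_of_inputs_le` over the range-honest core clause).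
[cite: Balaban1985UV3, Thm 1 p.257 + Thm 2 p.272 + p.256 L15–18] -/
theorem uvStability3D_of_inputsEq324CoreLT_le
    (𝔠 : ∀ (G : Type) [GaugeGroup G] [MeasurableSpace G] [HaarData G] (𝔊 : GroupModel G), AlphaConsts L 𝔊.N)
    (X : ∀ (G : Type) [GaugeGroup G] [MeasurableSpace G] [HaarData G], GroupModel G → ∀ S : Scales L, ExternalInputs S G)
    (𝔖 : ∀ (G : Type) [GaugeGroup G] [MeasurableSpace G] [HaarData G] (𝔊 : GroupModel G) (S : Scales L) (k : ℕ),
      StepSeries S G ↥(lieC 𝔊) (nblkOf S (𝔠 G 𝔊).lane.carrier k) k)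
    (𝔄 : ∀ (G : Type) [GaugeGroup G] [MeasurableSpace G] [HaarData G] (𝔊 : GroupModel G) (S : Scales L),
      AlphaDataLT 𝔊 (𝔠 G 𝔊) (X G 𝔊 S) (𝔖 G 𝔊 S))
    (G : Type) [GaugeGroup G] [MeasurableSpace G] [HaarData G] (𝔊 : GroupModel G)
    (hα : ∀ S : Scales L, S.g ^ 2 * S.ε₀ ≤ (min (𝔠 G 𝔊).gamma0 1) ^ 2 →
      RunAlphaEq324CoreLT 𝔊 (𝔠 G 𝔊) (X G 𝔊 S) (𝔖 G 𝔊 S) (𝔄 G 𝔊 S)) :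
    Thm1PrintedCompact (runsLE (laneT 𝔠 X 𝔖).toConstruction G 𝔊 ((min (𝔠 G 𝔊).gamma0 1) ^ 2)) ∧
      Thm2Printed (runsLE (laneT 𝔠 X 𝔖).toConstruction G 𝔊 ((min (𝔠 G 𝔊).gamma0 1) ^ 2)) :=
  uvStability3D_compact_subfamily (laneT 𝔠 X 𝔖).toConstruction (𝔠 G 𝔊).lane.consts (𝔠 G 𝔊).lane.normalised (laneT 𝔠 X 𝔖).tower
    (fun G _ _ _ 𝔊 S => (laneT 𝔠 X 𝔖).tower_toRunData G 𝔊 S) (fun S : ScalesLE L ((min (𝔠 G 𝔊).gamma0 1) ^ 2) => S.1) G 𝔊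
    (fun S => { toCarrierEqs := carrierEqs_pin _ (usesConsts_inputOf (𝔠 G 𝔊).lane (X G 𝔊 S.1) (𝔖 G 𝔊 S.1) fun _ => True),
                toAnalyticLeaves := analyticLeavesOf (runResiduals_of_alphaEq324CoreLT_le S.2 (hα S.1 S.2)) })

end End

end Summit.QuantumFields.YangMills.Theorems.BalabanUVNodesN08AlphaEq324RowRange

end
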